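import Mathlib

/-!
# Route `SymPencil` — a rank obstruction for weighted sums of squares of bilinear forms: TWO
# ISOTROPIC FAMILIES CANNOT PAIR NON-DEGENERATELY IN FEWER THAN TWICE THEIR RANK
# (`--supports` stmt-ValiantsHypothesis-5674 `SdcSuperquadratic`; (9,7) column of the size-28
# table, the CROSS branch; rung currency only — nothing here bears on `VP ≠ VNP`)

Linear algebra behind the cross-nine statement of `…CellNineSevenTwentyEight` (row `r = 9` of
the size-`28` table).  Let `⟨v, w⟩_c = Σ_r c_r v_r w_r` on `K^ι` with all `c_r ≠ 0`
(non-degenerate), and let `Φ : V → K^ι` be linear with `⟨Φ u, Φ u'⟩_c = 0` for all `u, u'`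
(the image is TOTALLY ISOTROPIC).  Then `2 · rank Φ ≤ |ι|` (`two_mul_finrank_range_le_of_isotropic`:
the image lies in its own orthogonal, `LinearMap.BilinForm.finrank_add_finrank_orthogonal`).
Consequently (`false_of_isotropic_pair`): if `dim V = 9`, `|ι| ≤ 9`, `Φ, Ψ : V → K^ι` are both
isotropic and the symmetrised pairing `b(u,u') = ⟨Φ u, Ψ u'⟩_c + ⟨Ψ u, Φ u'⟩_c` is non-degenerate on
`V`, contradiction — `ker Φ ∩ ker Ψ` has dimension `≥ 9 − 4 − 4 = 1` and lies in the radical of `b`.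
(Use: a weighted sum of NINE squares of bilinear forms `β_k(u, y)` representing a pairing
`Q(u; y₁ + y₂)` with `Q(u; y₁) = Q(u; y₂) = 0` and `rank_u Q(·; y₁ + y₂) = 9` cannot exist.)

Honest framing: pure linear algebra; no cell closes here; nothing about the determinantal
complexity of `per_4` is claimed; stmt-5674 `SdcSuperquadratic` OPEN; `VP ≠ VNP` not moved.  No
definitions, no named facts. [folklore]
-/

noncomputable section

-- single-conjunct layout: Sub = Summit, duplicated namespace component intended
set_option linter.dupNamespace false

namespace Summit.ValiantsHypothesis.ValiantsHypothesis.Theorems.SymPencilPerFourIsotropicPairRank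

open Matrix Finset Module

universe u v w

variable {K : Type u} [Field K]

/-- **A totally isotropic image has rank at most half the dimension**: if
`Σ_r c_r (Φ u)_r (Φ u')_r = 0` for all `u, u'` and every weight `c_r` is non-zero, then
`2 · dim (im Φ) ≤ |ι|`. [folklore] -/
theorem two_mul_finrank_range_le_of_isotropic {ι : Type v} [Fintype ι] [DecidableEq ι]
    {V : Type w} [AddCommGroup V] [Module K V]
    (c : ι → K) (hc : ∀ r, c r ≠ 0) (Φ : V →ₗ[K] (ι → K))
    (hiso : ∀ u u' : V, ∑ r, c r * Φ u r * Φ u' r = 0) :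
    2 * finrank K (LinearMap.range Φ) ≤ Fintype.card ι := by
  classical
  -- the weighted dot product as a bilinear form
  set B : LinearMap.BilinForm K (ι → K) := Matrix.toBilin' (Matrix.diagonal c) with hB
  have hBap : ∀ v w : ι → K, B v w = ∑ r, c r * v r * w r := by
    intro v w
    rw [hB, Matrix.toBilin'_apply']
    simp only [dotProduct, Matrix.mulVec_diagonal]
    exact Finset.sum_congr rfl fun r _ => by ring
  have hBnd : B.Nondegenerate := by
    rw [hB, Matrix.nondegenerate_toBilin'_iff, Matrix.nondegenerate_iff_det_ne_zero,
      Matrix.det_diagonal]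
    exact Finset.prod_ne_zero_iff.2 fun r _ => hc r
  have hrefl : B.IsRefl := by
    intro x y hxy
    rw [hBap] at hxy ⊢
    rw [← hxy]
    exact Finset.sum_congr rfl fun r _ => by ring
  set W := LinearMap.range Φ with hW
  have hle : W ≤ B.orthogonal W := by
    rintro _ ⟨u', rfl⟩
    rw [LinearMap.BilinForm.mem_orthogonal_iff]
    rintro _ ⟨u, rfl⟩
    -- `B.IsOrtho (Φ u) (Φ u')`
    show B (Φ u) (Φ u') = 0
    rw [hBap]
    exact hiso u u'
  have hsum := LinearMap.BilinForm.finrank_add_finrank_orthogonal hrefl W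
  rw [LinearMap.BilinForm.orthogonal_top_eq_bot hBnd, inf_bot_eq, finrank_bot, add_zero,
    finrank_fintype_fun_eq_card] at hsum
  have hmono := Submodule.finrank_mono hle
  omega

/-- ★ **Two isotropic families cannot pair non-degenerately on a `9`-space with `≤ 9` squares.**
[folklore] -/
theorem false_of_isotropic_pair {ι : Type v} [Fintype ι] [DecidableEq ι]
    (hι : Fintype.card ι ≤ 9) {V : Type w} [AddCommGroup V] [Module K V] [FiniteDimensional K V]
    (hV : finrank K V = 9) (c : ι → K) (hc : ∀ r, c r ≠ 0) (Φ Ψ : V →ₗ[K] (ι → K))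
    (hΦ : ∀ u u' : V, ∑ r, c r * Φ u r * Φ u' r = 0)
    (hΨ : ∀ u u' : V, ∑ r, c r * Ψ u r * Ψ u' r = 0)
    (b : V → V → K)
    (hb : ∀ u u' : V, b u u' = ∑ r, c r * (Φ u r * Ψ u' r + Ψ u r * Φ u' r))
    (hnd : ∀ u : V, (∀ u' : V, b u u' = 0) → u = 0) : False := by
  classical
  have hΦ4 := two_mul_finrank_range_le_of_isotropic c hc Φ hΦ
  have hΨ4 := two_mul_finrank_range_le_of_isotropic c hc Ψ hΨ
  have hkΦ := LinearMap.finrank_range_add_finrank_ker Φ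
  have hkΨ := LinearMap.finrank_range_add_finrank_ker Ψ
  rw [hV] at hkΦ hkΨ
  have hsup := Submodule.finrank_sup_add_finrank_inf_eq (LinearMap.ker Φ) (LinearMap.ker Ψ)
  have hle : finrank K ↥(LinearMap.ker Φ ⊔ LinearMap.ker Ψ) ≤ 9 := hV ▸ Submodule.finrank_le _
  have hpos : 0 < finrank K ↥(LinearMap.ker Φ ⊓ LinearMap.ker Ψ) := by omega
  have hne : LinearMap.ker Φ ⊓ LinearMap.ker Ψ ≠ ⊥ := by
    intro h; rw [h, finrank_bot] at hpos; exact lt_irrefl 0 hpos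
  obtain ⟨u, hu, hu0⟩ := Submodule.exists_mem_ne_zero_of_ne_bot hne
  obtain ⟨huΦ, huΨ⟩ := Submodule.mem_inf.1 hu
  rw [LinearMap.mem_ker] at huΦ huΨ
  refine hu0 (hnd u fun u' => ?_)
  rw [hb, huΦ, huΨ]
  simp

/-- ★ **The same with arbitrary weights** (drop the zero ones: the surviving index set is still
of size `≤ 9` and every sum is unchanged). [folklore] -/
theorem false_of_isotropic_pair_weights {ι : Type v} [Fintype ι] [DecidableEq ι]
    (hι : Fintype.card ι ≤ 9) {V : Type w} [AddCommGroup V] [Module K V] [FiniteDimensional K V]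
    (hV : finrank K V = 9) (c : ι → K) (Φ Ψ : V →ₗ[K] (ι → K))
    (hΦ : ∀ u u' : V, ∑ r, c r * Φ u r * Φ u' r = 0)
    (hΨ : ∀ u u' : V, ∑ r, c r * Ψ u r * Ψ u' r = 0)
    (b : V → V → K)
    (hb : ∀ u u' : V, b u u' = ∑ r, c r * (Φ u r * Ψ u' r + Ψ u r * Φ u' r))
    (hnd : ∀ u : V, (∀ u' : V, b u u' = 0) → u = 0) : False := by
  classical
  let ι' := {r : ι // c r ≠ 0}
  have hι' : Fintype.card ι' ≤ 9 := (Fintype.card_subtype_le _).trans hι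
  -- sums over `ι` with weights `c` are sums over `ι'`
  have key : ∀ F : ι → K, ∑ r : ι', c r.1 * F r.1 = ∑ r, c r * F r := by
    intro F
    have h : ∑ r ∈ Finset.univ.filter (fun r => c r ≠ 0), c r * F r =
        ∑ r : ι', c r.1 * F r.1 := Finset.sum_subtype _ (fun r => by simp) _
    rw [← h]
    exact Finset.sum_filter_of_ne fun r _ hr hc0 => hr (by rw [hc0, zero_mul])
  -- restriction of the coordinates to `ι'`
  let R : (ι → K) →ₗ[K] (ι' → K) :=
    { toFun := fun v r => v r.1
      map_add' := fun v w => rfl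
      map_smul' := fun a v => rfl }
  have hR : ∀ v (r : ι'), R v r = v r.1 := fun _ _ => rfl
  refine false_of_isotropic_pair hι' hV (fun r : ι' => c r.1) (fun r => r.2) (R ∘ₗ Φ) (R ∘ₗ Ψ)
    ?_ ?_ b ?_ hnd
  · intro u u'
    simp only [LinearMap.coe_comp, Function.comp_apply, hR]
    calc ∑ x : ι', c x.1 * Φ u x.1 * Φ u' x.1 = ∑ x : ι', c x.1 * (Φ u x.1 * Φ u' x.1) :=
          Finset.sum_congr rfl fun r _ => by ring
      _ = ∑ r, c r * (Φ u r * Φ u' r) := key (fun r => Φ u r * Φ u' r)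
      _ = ∑ r, c r * Φ u r * Φ u' r := Finset.sum_congr rfl fun r _ => by ring
      _ = 0 := hΦ u u'
  · intro u u'
    simp only [LinearMap.coe_comp, Function.comp_apply, hR]
    calc ∑ x : ι', c x.1 * Ψ u x.1 * Ψ u' x.1 = ∑ x : ι', c x.1 * (Ψ u x.1 * Ψ u' x.1) :=
          Finset.sum_congr rfl fun r _ => by ring
      _ = ∑ r, c r * (Ψ u r * Ψ u' r) := key (fun r => Ψ u r * Ψ u' r)
      _ = ∑ r, c r * Ψ u r * Ψ u' r := Finset.sum_congr rfl fun r _ => by ring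
      _ = 0 := hΨ u u'
  · intro u u'
    simp only [LinearMap.coe_comp, Function.comp_apply, hR]
    rw [hb u u']
    exact (key (fun r => Φ u r * Ψ u' r + Ψ u r * Φ u' r)).symm

end Summit.ValiantsHypothesis.ValiantsHypothesis.Theorems.SymPencilPerFourIsotropicPairRank

end
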